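import Summits.QuantumFields.YangMills.Theorems.BalabanUVNodesN18TransportLettersAssembly
import Summits.QuantumFields.YangMills.Theorems.BalabanUVNodesN18CombStepMinRecordLetters
import HarnessLib

/-!
# BalabanUVNodes ∕ node N18 = NE5 — closure-ledger item (iii), comb step M4c, file (6i): G⁗″ — BOTH TRANSPORT CLAUSES FROM DISPLAYED PER-STEP NUMERICS WITH THE COMB,
# SHARP `δ₁`∕`a₁`, AND THE BEST OF BOTH C¹ SUMS `S₁f j = min(S₁, S₁♯)`

(Track A, DAG node N18 = `T4OutputRate.NE5`; cluster K4 «SpineRates», key item K3⁸ `SpineGivenEndpointR13SepCoPHV` (stmt-QuantumFields-27366);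
seat pub-ymgap-dag-n18-w3 g5, INTENT-6 = design step M4c.)  Count-neutral helper (`--supports stmt-QuantumFields-27366 --as helper`); K3⁸∕K3⁷ NOT claimed,
NOT closed; NE5 NOT printed ∕ NOT proved; N18 NOT discharged; YM mass gap (Clay) NOT proved by any of this; R4 closes the conditional finite-𝕋⁴ rung
`BalabanLadder.UV` only.

WHAT.  (6g) `…_of_combLipschitz` VERBATIM with (6f) replaced by (6h) `comb_letters_min_TΦOfRecord`: the defining equation of the C¹ rate is
`S₁f j = min(S₁(j), S₁♯(j))` — (4e)/(5c)'s sum (with the `2R∕ξ²` floor, small constant; best at j ≤ 2) and M4c's coarse-Lipschitz sum (every side term `O(η_j)`,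
envelope constant 8·10⁵ℓ²; best at j ≥ 3), cf. NUMERICS-M4C.md; hypotheses = those of (6g) (`htApos`, `hcomb` at 384).
* ★★★★★★★★★★ `admTransport_spaceOfRecord_unit_ofRecord_orbit_of_combMin`.

0 `def`, 0 `sorry`.  References: T. Bałaban, CMP **109** (1987) [Balaban1987RG1] ((0.4) p.253, (0.24)–(0.25) p.257, (1.10)–(1.16) p.262, (2.17) p.269);
CMP **98** (1985) [Balaban1985Averaging] (Prop. 3 (122)–(126) p.36, (62)–(63) p.28); C. King, CMP **102** (1986) [King1986] ((3.43)–(3.47) p.661).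
-/
noncomputable section

open scoped BigOperators Matrix.Norms.L2Operator

namespace YMDAG.N18.TransportOfRecord

open Complex (I)
open Literature.MathematicalPhysics.QuantumFieldTheory.Balaban1983to89
open Literature.MathematicalPhysics.QuantumFieldTheory.Balaban1983to89.T4Continuum
open Literature.MathematicalPhysics.QuantumFieldTheory.Balaban1983to89.T4LevelShift
open Literature.MathematicalPhysics.QuantumFieldTheory.Balaban1983to89.BlockAveraging
open Literature.MathematicalPhysics.QuantumFieldTheory.Balaban1983to89.B12RegularSpaces111
open Literature.MathematicalPhysics.QuantumFieldTheory.Balaban1983to89.B12RegularSpaces111SpecialUnitary (suModel mem_suModel_G mem_suModel_Gc mem_suModel_gc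
  suModel_norm_le suModel_G_le_Gc suModel_gc_conj suModel_gc_newPot)
open Literature.MathematicalPhysics.QuantumFieldTheory.Balaban1983to89.B12Membership313II (newPot)
open Literature.MathematicalPhysics.QuantumFieldTheory.Balaban1983to89.ExpMeanLog (deltaSU)
open Literature.MathematicalPhysics.QuantumFieldTheory.Balaban1983to89.MatrixLog (mlog)
open Literature.MathematicalPhysics.QuantumFieldTheory.Balaban1983to89.Node00 (MatA ιSU plaqInside)
open Literature.MathematicalPhysics.QuantumFieldTheory.Balaban1983to89.Node00.Sect2 (domSys domSites domCount CPair ofBackgroundC frameI Setting Residual regionOfSet)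
open Literature.MathematicalPhysics.QuantumFieldTheory.Balaban1983to89.Node00.W1
open Summit.QuantumFields.BalabanUV.T4Continuum.B13Carriers (transportRaw)
open Literature.MathematicalPhysics.QuantumFieldTheory.Balaban1983to89.B7Prop1Explicit (U1 mem_U1)



/-! ## Both transport clauses from displayed per-step numerics, with the comb generator of record -/

section Record

variable (F : T4Family) (N M k : ℕ) [NeZero N]

/-- ★★★★★★★ **BOTH TRANSPORT CLAUSES OF N18's READING AT THE TABLE OF RECORD FROM DISPLAYED PER-STEP NUMERICS, WITH THE COMB GENERATOR OF RECORD AND ITS SHARP C¹ LETTER**: FILE G's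
hypotheses (models `= suModel N` at runs `k, k+1`, `hGc`, top-radius numerics, the per-step numerics of FILES B∕D∕E∕F), the numerics of the complex plaquette letter (FILE (7c)),
and — in place of p622641's trivial comb — the comb generator `l = iη·λ̄_{Ad(axialT U (emb ·))A′_X}` of `…CombStepC0Letters` with its rates: `tA j ≥ (ℓ∕2)α₀(k+1,j+1)η_{j+1}²`
(axial-gauge radius), `δ₀f j = η_{j+1}ℓα₁(k+1,j+1)∕η_j`, `δ₁f j = 2η_{j+1}ℓα₁(k+1,j+1)∕η_j²` (crude), `S₀f j` (the C⁰ cancelled sum: leading `(η_{j+1}L∕η_j)·α₁(k+1,j+1)`,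
coefficient ONE, plus second order), `S₁f j` (the C¹ cancelled sum of (4e), coefficient ONE on `α₁(k+1,j+1)`), and the displayed side conditions `hcomb`, `hs16`, `hα0'`, `hc0`, `hc1` (both at coefficient one).  Conclusion VERBATIM
FILE 7's. [cite: Balaban1987RG1, (0.21)-(0.25) pp.256-257, (1.10)-(1.16) p.262; Balaban1985Averaging, (62)-(63) p.28, Props. 1-3 pp.26-36] -/
theorem admTransport_spaceOfRecord_unit_ofRecord_orbit_of_combMin (Sg : ℕ → Setting (MatA N) (Node00.SU N)) (α₀ α₁ : ℕ → ℕ → ℝ) (α₀A : ℕ → ℝ)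
    (hMA : (Sg k).𝓜 = suModel N) (hMB : (Sg (k + 1)).𝓜 = suModel N)
    (hGc : (Sg (k + 1)).𝓜.Gc ≤ (Sg k).𝓜.Gc)
    (hcB : 0 ≤ (Sg k).cB) (hcBB : 0 ≤ (Sg (k + 1)).cB) (hM : 0 < M) (ha : 0 ≤ α₀ (k + 1) 0)
    (haδ : (((((F.P (k + 1)).d + 2) * (F.P (k + 1)).L : ℕ) : ℝ) ^ 2 / 4) * α₀ (k + 1) 0 < deltaSU (Fin N))
    (hα : ∀ j, 0 < α₀ k j) (hα0B : ∀ j, 0 ≤ α₀ (k + 1) j) (hα1B : ∀ j, 0 ≤ α₁ (k + 1) j) (hα0A : ∀ j, 0 < α₀A j)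
    -- per-step numerics of FILES B ∕ D ∕ E ∕ F
    (hξ₁ : ∀ j, (F.P (k + 1)).eta (j + 1) * α₁ (k + 1) (j + 1) ≤ 1 / 4)
    (hsm : ∀ j, (((((F.P (k + 1)).d + 2) * (F.P (k + 1)).L : ℕ) : ℝ) ^ 2 / 4) * (α₀ (k + 1) (j + 1) * (F.P (k + 1)).eta (j + 1) ^ 2) +
        ((1 + 2 * (2 * ((F.P (k + 1)).eta (j + 1) * α₁ (k + 1) (j + 1)))) ^ (((F.P (k + 1)).d + 2) * (F.P (k + 1)).L) - 1) ≤ 1 / 2)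
    (hguard2 : ∀ j, (((((F.P (k + 1)).d + 2) * (F.P (k + 1)).L : ℕ) : ℝ) ^ 2 / 4) * (α₀ (k + 1) (j + 1) * (F.P (k + 1)).eta (j + 1) ^ 2) < deltaSU (Fin N))
    (hguard4 : ∀ j, (((((F.P (k + 1)).d + 4) * (F.P (k + 1)).L : ℕ) : ℝ) ^ 2 / 4) * (α₀ (k + 1) (j + 1) * (F.P (k + 1)).eta (j + 1) ^ 2) ≤ deltaSU (Fin N) / 2)
    (hρ3 : ∀ j, 22 * ((((((F.P (k + 1)).d + 2) * (F.P (k + 1)).L : ℕ) : ℝ) ^ 2 / 4) * (α₀ (k + 1) (j + 1) * (F.P (k + 1)).eta (j + 1) ^ 2) +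
        ((1 + 2 * (2 * ((F.P (k + 1)).eta (j + 1) * α₁ (k + 1) (j + 1)))) ^ (((F.P (k + 1)).d + 2) * (F.P (k + 1)).L) - 1)) ≤ 1 / 3)
    (hρπ : ∀ j, (N : ℝ) * (22 * ((((((F.P (k + 1)).d + 2) * (F.P (k + 1)).L : ℕ) : ℝ) ^ 2 / 4) * (α₀ (k + 1) (j + 1) * (F.P (k + 1)).eta (j + 1) ^ 2) +
        ((1 + 2 * (2 * ((F.P (k + 1)).eta (j + 1) * α₁ (k + 1) (j + 1)))) ^ (((F.P (k + 1)).d + 2) * (F.P (k + 1)).L) - 1))) < Real.pi)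
    (h3 : ∀ j, (((((F.P (k + 1)).d + 2) * (F.P (k + 1)).L : ℕ) : ℝ) ^ 2 / 2) * (α₀ (k + 1) (j + 1) * (F.P (k + 1)).eta (j + 1) ^ 2) +
        ((1 + 2 * (2 * ((F.P (k + 1)).eta (j + 1) * α₁ (k + 1) (j + 1)))) ^ (((F.P (k + 1)).d + 2) * (F.P (k + 1)).L) - 1) ≤ 1 / 3)
    (hπ : ∀ j, (N : ℝ) * ((((((F.P (k + 1)).d + 2) * (F.P (k + 1)).L : ℕ) : ℝ) ^ 2 / 2) * (α₀ (k + 1) (j + 1) * (F.P (k + 1)).eta (j + 1) ^ 2) +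
        ((1 + 2 * (2 * ((F.P (k + 1)).eta (j + 1) * α₁ (k + 1) (j + 1)))) ^ (((F.P (k + 1)).d + 2) * (F.P (k + 1)).L) - 1)) < Real.pi)
    (hplaqA : ∀ j, ((F.P (k + 1)).L : ℝ) ^ 2 * (α₀ (k + 1) (j + 1) * (F.P (k + 1)).eta (j + 1) ^ 2) +
        143 * ((((((F.P (k + 1)).d + 4) * (F.P (k + 1)).L : ℕ) : ℝ) ^ 2 / 4) * (α₀ (k + 1) (j + 1) * (F.P (k + 1)).eta (j + 1) ^ 2)) ^ 2 < α₀A j * (F.P k).eta j ^ 2)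
    (h48 : ∀ j, 48 * (((((F.P (k + 1)).d + 2) * (F.P (k + 1)).L : ℕ) : ℝ) * ((F.P (k + 1)).eta (j + 1) * ((Sg (k + 1)).cB * α₀ (k + 1) (j + 1)))) ≤ 1)
    (hN : ∀ j, 4 * (((((F.P (k + 1)).d + 2) * (F.P (k + 1)).L : ℕ) : ℝ) * ((F.P (k + 1)).eta (j + 1) * ((Sg (k + 1)).cB * α₀ (k + 1) (j + 1)))) < deltaSU (Fin N))
    (hπc : ∀ j, (N : ℝ) * (2 * ((F.P (k + 1)).eta (j + 1) * ((Sg (k + 1)).cB * α₀ (k + 1) (j + 1)))) < Real.pi)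
    (h1A : ∀ j, ((F.P (k + 1)).L : ℝ) * ((Sg (k + 1)).cB * α₀ (k + 1) (j + 1)) +
        3200 * (((((F.P (k + 1)).d + 2) * (F.P (k + 1)).L : ℕ) : ℝ)) ^ 2 * (F.P (k + 1)).eta (j + 1) * ((Sg (k + 1)).cB * α₀ (k + 1) (j + 1)) ^ 2 <
      (F.P (k + 1)).L * ((Sg k).cB * α₀A j))
    -- the numerics of the complex plaquette letter (FILE (7c)) and of the trivial comb, per step `j`; `tB`, `bB` = the two- ∕ four-block loop rates
    (tB bB : ℕ → ℝ)
    (ht2 : ∀ j, (1 + (1 + 2 * ((F.P (k + 1)).eta (j + 1) * α₁ (k + 1) (j + 1))) ^ (2 * (((F.P (k + 1)).d + 2) * (F.P (k + 1)).L / 2) + 1) * ((1 + 2 * ((F.P (k + 1)).eta (j + 1) * α₁ (k + 1) (j + 1))) ^ (4 * (((F.P (k + 1)).d + 2) * (F.P (k + 1)).L / 2)) * (((((F.P (k + 1)).d + 2) * (F.P (k + 1)).L / 2) : ℕ) * ((1 + 2 * ((F.P (k + 1)).eta (j + 1) * α₁ (k + 1) (j + 1))) ^ 6 * ((1 + 2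 * ((F.P (k + 1)).eta (j + 1) * α₁ (k + 1) (j + 1))) ^ 4 * (α₀ (k + 1) (j + 1) * (F.P (k + 1)).eta (j + 1) ^ 2))) *
          ((1 + 2 * ((F.P (k + 1)).eta (j + 1) * α₁ (k + 1) (j + 1))) ^ 2 * (1 + (1 + 2 * ((F.P (k + 1)).eta (j + 1) * α₁ (k + 1) (j + 1))) ^ 6 * ((1 + 2 * ((F.P (k + 1)).eta (j + 1) * α₁ (k + 1) (j + 1))) ^ 4 * (α₀ (k + 1) (j + 1) * (F.P (k + 1)).eta (j + 1) ^ 2)))) ^ (((F.P (k + 1)).d + 2) * (F.P (k + 1)).L / 2)))) ^ (((F.P (k + 1)).d + 2) * (F.P (k + 1)).L) - 1 ≤ tB j)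
    (ht : ∀ j, tB j ≤ 1 / 2)
    (hb4 : ∀ j, (1 + (1 + 2 * ((F.P (k + 1)).eta (j + 1) * α₁ (k + 1) (j + 1))) ^ (2 * (((F.P (k + 1)).d + 4) * (F.P (k + 1)).L / 2) + 1) * ((1 + 2 * ((F.P (k + 1)).eta (j + 1) * α₁ (k + 1) (j + 1))) ^ (4 * (((F.P (k + 1)).d + 4) * (F.P (k + 1)).L / 2)) * (((((F.P (k + 1)).d + 4) * (F.P (k + 1)).L / 2) : ℕ) * ((1 + 2 * ((F.P (k + 1)).eta (j + 1) * α₁ (k + 1) (j + 1))) ^ 6 * ((1 + 2 * ((F.P (k + 1)).eta (j + 1) * α₁ (k + 1) (j + 1))) ^ 4 * (α₀ (k + 1) (j + 1) * (F.P (k + 1)).eta (j + 1) ^ 2))) *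
          ((1 + 2 * ((F.P (k + 1)).eta (j + 1) * α₁ (k + 1) (j + 1))) ^ 2 * (1 + (1 + 2 * ((F.P (k + 1)).eta (j + 1) * α₁ (k + 1) (j + 1))) ^ 6 * ((1 + 2 * ((F.P (k + 1)).eta (j + 1) * α₁ (k + 1) (j + 1))) ^ 4 * (α₀ (k + 1) (j + 1) * (F.P (k + 1)).eta (j + 1) ^ 2)))) ^ (((F.P (k + 1)).d + 4) * (F.P (k + 1)).L / 2)))) ^ (4 * (F.P (k + 1)).L) - 1 ≤ bB j)
    (hplaqC : ∀ j, bB j + 6 * tB j * ((1 + 2 * ((F.P (k + 1)).eta (j + 1) * α₁ (k + 1) (j + 1))) ^ (F.P (k + 1)).L) ^ 4 * ((1 + 6 * tB j) ^ 3 + (1 + 6 * tB j) ^ 2 + (2 + 6 * tB j)) <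
      α₀A j * (F.P k).eta j ^ 2)
    -- the comb generator of record: its rates (defining equations) and the displayed side conditions of FILE 7 at these rates
    (tA δ₀f δ₁f S₀f S₁f a₁f : ℕ → ℝ)
    (htA : ∀ j, ((((((F.P (k + 1)).d + 4) * (F.P (k + 1)).L : ℕ) : ℝ)) / 2) * (α₀ (k + 1) (j + 1) * (F.P (k + 1)).eta (j + 1) ^ 2) ≤ tA j)
    (htApos : ∀ j, 0 < tA j)
    (hcomb : ∀ j, 384 * (((((F.P (k + 1)).d + 2) * (F.P (k + 1)).L : ℕ) : ℝ)) * ((2 * ((F.P (k + 1)).eta (j + 1) * α₁ (k + 1) (j + 1)) + tA j + 2 * ((F.P (k + 1)).eta (j + 1) * α₁ (k + 1) (j + 1)) * tA j) + tA j) ≤ 1)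
    (hδ₀f : ∀ j, δ₀f j = (F.P (k + 1)).eta (j + 1) * ((((((F.P (k + 1)).d + 2) * (F.P (k + 1)).L : ℕ) : ℝ)) * α₁ (k + 1) (j + 1)) / (F.P k).eta j)
    (hδ₁f : ∀ j, δ₁f j = ((F.P (k + 1)).eta (j + 1) / (F.P k).eta j *
      (69 * (((((F.P (k + 1)).d + 2) * (F.P (k + 1)).L : ℕ) : ℝ)) ^ 2 * tA j * α₁ (k + 1) (j + 1) +
        (((((F.P (k + 1)).d + 2) * (F.P (k + 1)).L : ℕ) : ℝ)) * (((F.P (k + 1)).L : ℝ) * ((F.P (k + 1)).eta (j + 1) * α₁ (k + 1) (j + 1) + 2 * tA j * α₁ (k + 1) (j + 1))))) / (F.P k).eta j)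
    (hS₀f : ∀ j, S₀f j = ((F.P (k + 1)).eta (j + 1) / (F.P k).eta j * (((F.P (k + 1)).L : ℝ) * α₁ (k + 1) (j + 1)) +
      (4 * (34 * (((((F.P (k + 1)).d + 2) * (F.P (k + 1)).L : ℕ) : ℝ)) * ((2 * ((F.P (k + 1)).eta (j + 1) * α₁ (k + 1) (j + 1)) + tA j + 2 * ((F.P (k + 1)).eta (j + 1) * α₁ (k + 1) (j + 1)) * tA j) + tA j)) ^ 2 +
        578 * (((((F.P (k + 1)).d + 2) * (F.P (k + 1)).L : ℕ) : ℝ)) ^ 2 * ((2 * ((F.P (k + 1)).eta (j + 1) * α₁ (k + 1) (j + 1)) + tA j + 2 * ((F.P (k + 1)).eta (j + 1) * α₁ (k + 1) (j + 1)) * tA j) + tA j) * tA j +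
        660 * (((((F.P (k + 1)).d + 2) * (F.P (k + 1)).L : ℕ) : ℝ)) ^ 2 * ((2 * ((F.P (k + 1)).eta (j + 1) * α₁ (k + 1) (j + 1)) + tA j + 2 * ((F.P (k + 1)).eta (j + 1) * α₁ (k + 1) (j + 1)) * tA j) ^ 2 + tA j ^ 2) +
        3 * (((((F.P (k + 1)).d + 2) * (F.P (k + 1)).L : ℕ) : ℝ)) * (2 * ((F.P (k + 1)).eta (j + 1) * α₁ (k + 1) (j + 1)) * tA j) +
        3 * (((((F.P (k + 1)).d + 2) * (F.P (k + 1)).L : ℕ) : ℝ)) * ((F.P (k + 1)).eta (j + 1) * α₁ (k + 1) (j + 1)) ^ 2) / (F.P k).eta j +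
      (F.P (k + 1)).eta (j + 1) / (F.P k).eta j * (69 * (((((F.P (k + 1)).d + 2) * (F.P (k + 1)).L : ℕ) : ℝ)) ^ 2 * tA j * α₁ (k + 1) (j + 1))))
    (hS₁f : ∀ j, S₁f j = min ((((F.P k).eta j)⁻¹ * ((F.P (k + 1)).eta (j + 1) / (F.P k).eta j * ((F.P (k + 1)).L : ℝ) *
        (69 * (((((F.P (k + 1)).d + 2) * (F.P (k + 1)).L : ℕ) : ℝ)) * tA j * α₁ (k + 1) (j + 1) + ((F.P (k + 1)).L : ℝ) * ((F.P (k + 1)).eta (j + 1) * α₁ (k + 1) (j + 1) + 2 * tA j * α₁ (k + 1) (j + 1))) +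
      2 * ((4 * (34 * (((((F.P (k + 1)).d + 2) * (F.P (k + 1)).L : ℕ) : ℝ)) * ((2 * ((F.P (k + 1)).eta (j + 1) * α₁ (k + 1) (j + 1)) + tA j + 2 * ((F.P (k + 1)).eta (j + 1) * α₁ (k + 1) (j + 1)) * tA j) + tA j)) ^ 2 +
        578 * (((((F.P (k + 1)).d + 2) * (F.P (k + 1)).L : ℕ) : ℝ)) ^ 2 * ((2 * ((F.P (k + 1)).eta (j + 1) * α₁ (k + 1) (j + 1)) + tA j + 2 * ((F.P (k + 1)).eta (j + 1) * α₁ (k + 1) (j + 1)) * tA j) + tA j) * tA j +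
        660 * (((((F.P (k + 1)).d + 2) * (F.P (k + 1)).L : ℕ) : ℝ)) ^ 2 * ((2 * ((F.P (k + 1)).eta (j + 1) * α₁ (k + 1) (j + 1)) + tA j + 2 * ((F.P (k + 1)).eta (j + 1) * α₁ (k + 1) (j + 1)) * tA j) ^ 2 + tA j ^ 2) +
        3 * (((((F.P (k + 1)).d + 2) * (F.P (k + 1)).L : ℕ) : ℝ)) * (2 * ((F.P (k + 1)).eta (j + 1) * α₁ (k + 1) (j + 1)) * tA j) +
        3 * (((((F.P (k + 1)).d + 2) * (F.P (k + 1)).L : ℕ) : ℝ)) * ((F.P (k + 1)).eta (j + 1) * α₁ (k + 1) (j + 1)) ^ 2) / (F.P k).eta j + (F.P (k + 1)).eta (j + 1) / (F.P k).eta j * (69 * (((((F.P (k + 1)).d + 2) * (F.P (k + 1)).L : ℕ) : ℝ)) ^ 2 * tA j * α₁ (k + 1) (j + 1))))))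
      (((F.P k).eta j)⁻¹ * ((F.P (k + 1)).eta (j + 1) / (F.P k).eta j * ((F.P (k + 1)).L : ℝ) * (69 * (((((F.P (k + 1)).d + 2) * (F.P (k + 1)).L : ℕ) : ℝ)) * tA j * α₁ (k + 1) (j + 1) + ((F.P (k + 1)).L : ℝ) * ((F.P (k + 1)).eta (j + 1) * α₁ (k + 1) (j + 1) + 2 * tA j * α₁ (k + 1) (j + 1))) +
      2 * ((F.P (k + 1)).eta (j + 1) / (F.P k).eta j * (69 * (((((F.P (k + 1)).d + 2) * (F.P (k + 1)).L : ℕ) : ℝ)) ^ 2 * tA j * α₁ (k + 1) (j + 1))) +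
      (4 * (17 * (((((F.P (k + 1)).d + 2) * (F.P (k + 1)).L : ℕ) : ℝ)) * tA j) * ((4 * (34 * (((((F.P (k + 1)).d + 2) * (F.P (k + 1)).L : ℕ) : ℝ)) * ((2 * ((F.P (k + 1)).eta (j + 1) * α₁ (k + 1) (j + 1)) + tA j + 2 * ((F.P (k + 1)).eta (j + 1) * α₁ (k + 1) (j + 1)) * tA j) + tA j)) ^ 2 +
        578 * (((((F.P (k + 1)).d + 2) * (F.P (k + 1)).L : ℕ) : ℝ)) ^ 2 * ((2 * ((F.P (k + 1)).eta (j + 1) * α₁ (k + 1) (j + 1)) + tA j + 2 * ((F.P (k + 1)).eta (j + 1) * α₁ (k + 1) (j + 1)) * tA j) + tA j) * tA j +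
        660 * (((((F.P (k + 1)).d + 2) * (F.P (k + 1)).L : ℕ) : ℝ)) ^ 2 * ((2 * ((F.P (k + 1)).eta (j + 1) * α₁ (k + 1) (j + 1)) + tA j + 2 * ((F.P (k + 1)).eta (j + 1) * α₁ (k + 1) (j + 1)) * tA j) ^ 2 + tA j ^ 2) +
        3 * (((((F.P (k + 1)).d + 2) * (F.P (k + 1)).L : ℕ) : ℝ)) * (2 * ((F.P (k + 1)).eta (j + 1) * α₁ (k + 1) (j + 1)) * tA j) +
        3 * (((((F.P (k + 1)).d + 2) * (F.P (k + 1)).L : ℕ) : ℝ)) * ((F.P (k + 1)).eta (j + 1) * α₁ (k + 1) (j + 1)) ^ 2) / (F.P k).eta j + (F.P (k + 1)).eta (j + 1) / (F.P k).eta j * (3 * (((((F.P (k + 1)).d + 2) * (F.P (k + 1)).L : ℕ) : ℝ)) ^ 2 * tA j * α₁ (k + 1) (j + 1))) +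
        (F.P (k + 1)).eta (j + 1) / (F.P k).eta j * (3 * (((((F.P (k + 1)).d + 2) * (F.P (k + 1)).L : ℕ) : ℝ)) ^ 2 * tA j * α₁ (k + 1) (j + 1)) +
        ((F.P k).eta j)⁻¹ * (800000 * (((((F.P (k + 1)).d + 2) * (F.P (k + 1)).L : ℕ) : ℝ)) ^ 2 * ((2 * ((F.P (k + 1)).eta (j + 1) * α₁ (k + 1) (j + 1)) + tA j + 2 * ((F.P (k + 1)).eta (j + 1) * α₁ (k + 1) (j + 1)) * tA j) + tA j) * ((F.P (k + 1)).eta (j + 1) * (((F.P (k + 1)).L : ℝ) * ((F.P (k + 1)).eta (j + 1) * α₁ (k + 1) (j + 1) + 2 * tA j * α₁ (k + 1) (j + 1))) + 2 * tA j))))))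
    (ha₁f : ∀ j, a₁f j = S₁f j + 2 * ((F.P (k + 1)).eta (j + 1) / (F.P k).eta j *
      (69 * (((((F.P (k + 1)).d + 2) * (F.P (k + 1)).L : ℕ) : ℝ)) ^ 2 * tA j * α₁ (k + 1) (j + 1) +
        (((((F.P (k + 1)).d + 2) * (F.P (k + 1)).L : ℕ) : ℝ)) * (((F.P (k + 1)).L : ℝ) * ((F.P (k + 1)).eta (j + 1) * α₁ (k + 1) (j + 1) + 2 * tA j * α₁ (k + 1) (j + 1))))) / (F.P k).eta j)
    (hs16 : ∀ j, (F.P k).eta j * ((2 * (22 * ((((((F.P (k + 1)).d + 2) * (F.P (k + 1)).L : ℕ) : ℝ) ^ 2 / 4) * (α₀ (k + 1) (j + 1) * (F.P (k + 1)).eta (j + 1) ^ 2) +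
        ((1 + 2 * (2 * ((F.P (k + 1)).eta (j + 1) * α₁ (k + 1) (j + 1)))) ^ (((F.P (k + 1)).d + 2) * (F.P (k + 1)).L) - 1))) / (F.P k).eta j) + 2 * δ₀f j) ≤ 1 / 16)
    (hα0' : ∀ j, Real.exp (2 * ((F.P k).eta j * δ₀f j)) * α₀A j ≤ α₀ k j)
    (hc0 : ∀ j, S₀f j + 4 * (F.P k).eta j * δ₀f j * ((2 * (22 * ((((((F.P (k + 1)).d + 2) * (F.P (k + 1)).L : ℕ) : ℝ) ^ 2 / 4) * (α₀ (k + 1) (j + 1) * (F.P (k + 1)).eta (j + 1) ^ 2) +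
        ((1 + 2 * (2 * ((F.P (k + 1)).eta (j + 1) * α₁ (k + 1) (j + 1)))) ^ (((F.P (k + 1)).d + 2) * (F.P (k + 1)).L) - 1))) / (F.P k).eta j) + δ₀f j) < α₁ k j)
    (hc1 : ∀ j, S₁f j +
          (4 * (StepConsts.ofParams (F.P k) (Sg k).cB j).ξ * (δ₀f j * a₁f j + (2 * (22 * ((((((F.P (k + 1)).d + 2) * (F.P (k + 1)).L : ℕ) : ℝ) ^ 2 / 4) * (α₀ (k + 1) (j + 1) * (F.P (k + 1)).eta (j + 1) ^ 2) +
        ((1 + 2 * (2 * ((F.P (k + 1)).eta (j + 1) * α₁ (k + 1) (j + 1)))) ^ (((F.P (k + 1)).d + 2) * (F.P (k + 1)).L) - 1))) / (F.P k).eta j) * (2 * (StepConsts.ofParams (F.P k) (Sg k).cB j).ξ * α₀A j * δ₀f j + δ₁f j)) +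
            4 * (StepConsts.ofParams (F.P k) (Sg k).cB j).ξ * (((2 * (22 * ((((((F.P (k + 1)).d + 2) * (F.P (k + 1)).L : ℕ) : ℝ) ^ 2 / 4) * (α₀ (k + 1) (j + 1) * (F.P (k + 1)).eta (j + 1) ^ 2) +
        ((1 + 2 * (2 * ((F.P (k + 1)).eta (j + 1) * α₁ (k + 1) (j + 1)))) ^ (((F.P (k + 1)).d + 2) * (F.P (k + 1)).L) - 1))) / (F.P k).eta j) + (9 / 8) * δ₀f j) * δ₁f j +
                δ₀f j * ((1 + 4 * ((StepConsts.ofParams (F.P k) (Sg k).cB j).ξ * δ₀f j)) * a₁f j +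
                  (1 + 4 * ((StepConsts.ofParams (F.P k) (Sg k).cB j).ξ * (2 * (22 * ((((((F.P (k + 1)).d + 2) * (F.P (k + 1)).L : ℕ) : ℝ) ^ 2 / 4) * (α₀ (k + 1) (j + 1) * (F.P (k + 1)).eta (j + 1) ^ 2) +
        ((1 + 2 * (2 * ((F.P (k + 1)).eta (j + 1) * α₁ (k + 1) (j + 1)))) ^ (((F.P (k + 1)).d + 2) * (F.P (k + 1)).L) - 1))) / (F.P k).eta j))) * (2 * (StepConsts.ofParams (F.P k) (Sg k).cB j).ξ * α₀A j * δ₀f j + δ₁f j)))) < α₁ k j) :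
    (∀ (X : Node00.W1.Dom (F.P k) M) (ψ : CPair (F.P (k + 1)) (MatA N)),
        ψ ∈ spaceOfRecord (M := M) (Sg (k + 1)) (Residual.unit (F.P (k + 1)) (MatA N)) (α₀ (k + 1)) (α₁ (k + 1)) (pairOfRecord F M k X).1
            (pairOfRecord F M k X).2 →
          TcfgOfRecord F N k ψ ∈ spaceOfRecord (M := M) (Sg k) (Residual.unit (F.P k) (MatA N)) (α₀ k) (α₁ k) X.1 X.2) ∧
      ∀ U : GaugeField (F.P (k + 1)) 0 (Node00.SU N),
        (∀ (j : ℕ) (Y : (domSys (F.P (k + 1)) M j).Dom),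
            ofBackgroundC (ιSU N) U ∈ spaceOfRecord (M := M) (Sg (k + 1)) (Residual.unit (F.P (k + 1)) (MatA N)) (α₀ (k + 1)) (α₁ (k + 1)) j Y) →
          ∀ (j : ℕ) (Y : (domSys (F.P k) M j).Dom),
            ofBackgroundC (ιSU N) (transportRaw F k (Node00.avOfRecord F N (k + 1) 0) U) ∈
              spaceOfRecord (M := M) (Sg k) (Residual.unit (F.P k) (MatA N)) (α₀ k) (α₁ k) j Y := by
  have hξpos : ∀ j, 0 < (StepConsts.ofParams (F.P k) (Sg k).cB j).ξ := fun j => by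
    show 0 < (F.P k).eta j
    exact pow_pos (inv_pos.mpr (Nat.cast_pos.mpr (F.P k).L_pos)) j
  have hξeq : ∀ j, (StepConsts.ofParams (F.P k) (Sg k).cB j).ξ = (F.P k).eta j := fun j => rfl
  have hηB : ∀ j, 0 ≤ (F.P (k + 1)).eta j := fun j => le_of_lt (pow_pos (inv_pos.mpr (Nat.cast_pos.mpr (F.P (k + 1)).L_pos)) j)
  refine admTransport_spaceOfRecord_unit_ofRecord_orbit_of_letters F N M k Sg α₀ α₁ hGc (fun g hg => ?_) ?_ (fun g hg X hX => ?_) (fun j X hX Y hY hs => ?_)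
    hcB hM ha haδ hα fun j Y Φ hΦ => ?_
  · rw [hMA] at hg; exact suModel_norm_le g hg
  · rw [hMA]; exact suModel_G_le_Gc
  · rw [hMA] at hg hX ⊢; exact suModel_gc_conj g hg X hX
  · rw [hMA] at hX hY ⊢; exact suModel_gc_newPot (le_of_lt (hξpos j)) X hX Y hY hs
  -- the table point: run B's pair
  rw [hMB] at hΦ
  have hsat := hΦ
  obtain ⟨-, -, U, A', hf, hI, hII, -⟩ := hΦ
  -- the discharged block: factorisation + condition (i) + 𝔤ᶜ + sizes
  obtain ⟨UA, AA, hfac, hcondI, heq, hgc, hA, hA1⟩ := exists_factors_condI_TΦOfRecord (Residual.unit (F.P (k + 1)) (MatA N)) (Residual.unit (F.P k) (MatA N))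
    M j Y hsat hf hI hII (hα0B (j + 1)) (hα1B (j + 1)) (mul_nonneg hcBB (hα0B (j + 1))) (hξ₁ j) (hsm j) (hguard2 j) (hguard4 j) (hρ3 j) (hρπ j)
    (h3 j) (hπ j) (hplaqA j) (h48 j) (hN j) (hπc j) (h1A j)
  have hUGc : ∀ b ∈ (frameI (Residual.unit (F.P k) (MatA N)) M j (domSites (F.P k) M j Y)).X.bonds, (TΦOfRecord F N k Φ).U b ∈ (Sg k).𝓜.Gc := fun b hb => by
    rw [hMA]
    exact TΦOfRecord_U_mem_suModel_Gc_of_satisfiesI_III_frameBond (Residual.unit (F.P (k + 1)) (MatA N)) M j Y hsat b hb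
      (le_of_lt (pow_pos (inv_pos.mpr (Nat.cast_pos.mpr (F.P (k + 1)).L_pos)) _)) (hα0B (j + 1)) (hα1B (j + 1)) (hξ₁ j) (h3 j) (hπ j)
  -- the complex plaquette letter (FILE (7c))
  have hplaq : ∀ p ∈ (frameI (Residual.unit (F.P k) (MatA N)) M j (domSites (F.P k) M j Y)).X.plaqs,
      ‖(↑(plaq (TΦOfRecord F N k Φ).U p) : MatA N) - 1‖ < α₀A j * (StepConsts.ofParams (F.P k) (Sg k).cB j).ξ ^ 2 := fun p hp => by
    have hξ₁' : (StepConsts.ofParams (F.P (k + 1)) (Sg (k + 1)).cB (j + 1)).ξ * α₁ (k + 1) (j + 1) ≤ 1 / 2 := (hξ₁ j).trans (by norm_num)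
    have h := norm_plaq_TΦOfRecord_U_sub_one_le_framePlaq (Residual.unit (F.P (k + 1)) (MatA N)) M j Y hsat (hηB (j + 1)) hξ₁' (hα0B (j + 1)) (hα1B (j + 1))
      (ht2 j) (ht j) (hb4 j) p hp
    rw [hξeq]
    exact lt_of_le_of_lt h (hplaqC j)
  -- `0 ≤ a`
  have hρ0 : 0 ≤ 22 * ((((((F.P (k + 1)).d + 2) * (F.P (k + 1)).L : ℕ) : ℝ) ^ 2 / 4) * (α₀ (k + 1) (j + 1) * (F.P (k + 1)).eta (j + 1) ^ 2) +
      ((1 + 2 * (2 * ((F.P (k + 1)).eta (j + 1) * α₁ (k + 1) (j + 1)))) ^ (((F.P (k + 1)).d + 2) * (F.P (k + 1)).L) - 1)) := by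
    have hηα : 0 ≤ (F.P (k + 1)).eta (j + 1) * α₁ (k + 1) (j + 1) := mul_nonneg (hηB (j + 1)) (hα1B (j + 1))
    have h1 : (1 : ℝ) ≤ (1 + 2 * (2 * ((F.P (k + 1)).eta (j + 1) * α₁ (k + 1) (j + 1)))) ^ (((F.P (k + 1)).d + 2) * (F.P (k + 1)).L) :=
      one_le_pow₀ (by linarith)
    have h2 : 0 ≤ (((((F.P (k + 1)).d + 2) * (F.P (k + 1)).L : ℕ) : ℝ) ^ 2 / 4) * (α₀ (k + 1) (j + 1) * (F.P (k + 1)).eta (j + 1) ^ 2) :=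
      mul_nonneg (by positivity) (mul_nonneg (hα0B (j + 1)) (sq_nonneg _))
    nlinarith
  have hη : 0 < (F.P k).eta j := hξpos j
  classical
  -- the comb generator of record and its letters (`…CombStepC0Letters` ★★★); `U_A ∈ SU(N) ⊂ U1` on the frame bonds (FILE D ★★★★)
  have hUA1 : ∀ b ∈ (frameI (Residual.unit (F.P k) (MatA N)) M j (domSites (F.P k) M j Y)).X.bonds,
      fieldShift (YMDAG.N18.TwoRunCubes.ladder F k) (avgUnits U) b ∈ U1 (MatA N) := fun b hb => by
    have hG := fieldShift_avgUnits_factor_mem_G_frameBond (Residual.unit (F.P (k + 1)) (MatA N)) M j Y hI (hα0B (j + 1)) (hguard2 j) b hb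
    exact mem_U1.mpr ⟨suModel_norm_le _ hG, suModel_norm_le _ ((suModel N).G.inv_mem hG)⟩
  obtain ⟨lrec, -, hltr, hl0, hl1, hS0, hS1, hA1s⟩ := comb_letters_min_TΦOfRecord (M := M) (k := k) (Residual.unit (F.P (k + 1)) (MatA N)) j Y (Φ := Φ) rfl hf hI hII
    (hα0B (j + 1)) (hα1B (j + 1)) (hξ₁ j) (htA j) (htApos j) (hcomb j) hUA1
  -- FILE F's formulas for `U_A`, `A′_A` on the frame bonds turn the letters into FILE 7's shapes
  have hξδ₀ : (StepConsts.ofParams (F.P k) (Sg k).cB j).ξ * δ₀f j =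
      (F.P (k + 1)).eta (j + 1) * ((((((F.P (k + 1)).d + 2) * (F.P (k + 1)).L : ℕ) : ℝ)) * α₁ (k + 1) (j + 1)) := by
    rw [hξeq, hδ₀f, mul_div_cancel₀ _ hη.ne']
  have hξδ₁ : (StepConsts.ofParams (F.P k) (Sg k).cB j).ξ * δ₁f j = ((F.P (k + 1)).eta (j + 1) / (F.P k).eta j *
      (69 * (((((F.P (k + 1)).d + 2) * (F.P (k + 1)).L : ℕ) : ℝ)) ^ 2 * tA j * α₁ (k + 1) (j + 1) +
        (((((F.P (k + 1)).d + 2) * (F.P (k + 1)).L : ℕ) : ℝ)) * (((F.P (k + 1)).L : ℝ) * ((F.P (k + 1)).eta (j + 1) * α₁ (k + 1) (j + 1) + 2 * tA j * α₁ (k + 1) (j + 1))))) := by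
    rw [hξeq, hδ₁f, mul_div_cancel₀ _ hη.ne']
  have hδ₀0 : 0 ≤ δ₀f j := by
    rw [hδ₀f]; exact div_nonneg (mul_nonneg (hηB (j + 1)) (mul_nonneg (Nat.cast_nonneg _) (hα1B (j + 1)))) hη.le
  refine ⟨UA, AA, lrec, α₀A j, α₀A j, _, a₁f j, δ₀f j, δ₁f j,
    (α₁ k j - 4 * (StepConsts.ofParams (F.P k) (Sg k).cB j).ξ * δ₀f j * ((2 * (22 * ((((((F.P (k + 1)).d + 2) * (F.P (k + 1)).L : ℕ) : ℝ) ^ 2 / 4) * (α₀ (k + 1) (j + 1) * (F.P (k + 1)).eta (j + 1) ^ 2) +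
        ((1 + 2 * (2 * ((F.P (k + 1)).eta (j + 1) * α₁ (k + 1) (j + 1)))) ^ (((F.P (k + 1)).d + 2) * (F.P (k + 1)).L) - 1))) / (F.P k).eta j) + δ₀f j)),
    (α₁ k j -
      (4 * (StepConsts.ofParams (F.P k) (Sg k).cB j).ξ * (δ₀f j * a₁f j + (2 * (22 * ((((((F.P (k + 1)).d + 2) * (F.P (k + 1)).L : ℕ) : ℝ) ^ 2 / 4) * (α₀ (k + 1) (j + 1) * (F.P (k + 1)).eta (j + 1) ^ 2) +
        ((1 + 2 * (2 * ((F.P (k + 1)).eta (j + 1) * α₁ (k + 1) (j + 1)))) ^ (((F.P (k + 1)).d + 2) * (F.P (k + 1)).L) - 1))) / (F.P k).eta j) * (2 * (StepConsts.ofParams (F.P k) (Sg k).cB j).ξ * α₀A j * δ₀f j + δ₁f j)) +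
            4 * (StepConsts.ofParams (F.P k) (Sg k).cB j).ξ * (((2 * (22 * ((((((F.P (k + 1)).d + 2) * (F.P (k + 1)).L : ℕ) : ℝ) ^ 2 / 4) * (α₀ (k + 1) (j + 1) * (F.P (k + 1)).eta (j + 1) ^ 2) +
        ((1 + 2 * (2 * ((F.P (k + 1)).eta (j + 1) * α₁ (k + 1) (j + 1)))) ^ (((F.P (k + 1)).d + 2) * (F.P (k + 1)).L) - 1))) / (F.P k).eta j) + (9 / 8) * δ₀f j) * δ₁f j +
                δ₀f j * ((1 + 4 * ((StepConsts.ofParams (F.P k) (Sg k).cB j).ξ * δ₀f j)) * a₁f j +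
                  (1 + 4 * ((StepConsts.ofParams (F.P k) (Sg k).cB j).ξ * (2 * (22 * ((((((F.P (k + 1)).d + 2) * (F.P (k + 1)).L : ℕ) : ℝ) ^ 2 / 4) * (α₀ (k + 1) (j + 1) * (F.P (k + 1)).eta (j + 1) ^ 2) +
        ((1 + 2 * (2 * ((F.P (k + 1)).eta (j + 1) * α₁ (k + 1) (j + 1)))) ^ (((F.P (k + 1)).d + 2) * (F.P (k + 1)).L) - 1))) / (F.P k).eta j))) * (2 * (StepConsts.ofParams (F.P k) (Sg k).cB j).ξ * α₀A j * δ₀f j + δ₁f j))))), (hα0A j).le, hα0A j, div_nonneg (mul_nonneg zero_le_two hρ0) hη.le, hδ₀0,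
    ?_, hα0' j, hα0' j, le_of_eq ?_, le_of_eq ?_, hUGc, hfac, ?_, ?_, hA, ?_, hplaq, ?_, ?_, ?_, ?_, ?_, ?_, ?_⟩
  · -- `ξ(a + 2δ₀) ≤ 1∕16`
    rw [hξeq]; exact hs16 j
  · -- `s₀ := α₁(k,j) − 4ξδ₀(a + δ₀)`
    exact sub_add_cancel (α₁ k j) _
  · -- `s₁ := α₁(k,j) − (…)`
    exact sub_add_cancel (α₁ k j) _
  · rw [hMA]; exact hcondI
  · intro b hb; rw [hMA]; exact hgc b hb
  · -- the SHARP `a₁`: `|∇A′_A| ≤ S₁ + 2D₁∕ξ` ((5b) (6)), `A′_A` by FILE F's formula on the frame bonds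
    intro q hq
    obtain ⟨h0, hμ, hν, hμν⟩ := hq
    have hbμ : (⟨q.1, q.2.1⟩ : PBond (F.P k) 0) ∈ (frameI (Residual.unit (F.P k) (MatA N)) M j (domSites (F.P k) M j Y)).X.bonds := ⟨h0, hμ⟩
    have hbν : (⟨q.1, q.2.2⟩ : PBond (F.P k) 0) ∈ (frameI (Residual.unit (F.P k) (MatA N)) M j (domSites (F.P k) M j Y)).X.bonds := ⟨h0, hν⟩
    have hbμν : (⟨q.1.shift q.2.1, q.2.2⟩ : PBond (F.P k) 0) ∈ (frameI (Residual.unit (F.P k) (MatA N)) M j (domSites (F.P k) M j Y)).X.bonds := ⟨hμ, hμν⟩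
    rw [nabla_congr (V := fieldShift (sitesPerDir_ladder F (K := k) (j := 0) rfl rfl) (avgUnits U))
      (G := fun y => (I * ((F.P k).eta j : ℂ))⁻¹ • mlog ((((TΦOfRecord F N k Φ).U ⟨y, q.2.2⟩ : (MatA N)ˣ) : MatA N) *
          (((fieldShift (sitesPerDir_ladder F (K := k) (j := 0) rfl rfl) (avgUnits U) ⟨y, q.2.2⟩)⁻¹ : (MatA N)ˣ) : MatA N)))
      ((heq _ hbμ).1) ((heq _ hbν).2) ((heq _ hbμν).2), ha₁f, hS₁f, hξeq]
    exact hA1s q ⟨h0, hμ, hν, hμν⟩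
  · intro x _; rw [hMA]; exact mem_suModel_gc.mpr (hltr x)
  · intro x; rw [hMA]; exact expUnit_neg_mem_Gc_of_trace (hltr x)
  · intro x _ X hX; rw [hMA] at hX ⊢; exact conj_mem_gc_of_mem _ hX
  · intro x hx; rw [hξδ₀]; exact hl0 x hx
  · -- `|∇_{U_A} l| ≤ ξδ₁`, `U_A = fieldShift (avgUnits U)` on the frame bond
    intro x μ hx hxμ
    rw [hξδ₁, nabla_congr (V := fieldShift (sitesPerDir_ladder F (K := k) (j := 0) rfl rfl) (avgUnits U)) (G := _) ((heq ⟨x, μ⟩ ⟨hx, hxμ⟩).1) rfl rfl, hξeq]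
    exact hl1 x μ hx hxμ
  · -- the C⁰ cancelled sum `< s₀`
    intro b hb
    obtain ⟨hUA, hAA⟩ := heq b hb
    rw [hAA, nabla_congr (V := fieldShift (sitesPerDir_ladder F (K := k) (j := 0) rfl rfl) (avgUnits U)) (G := _) ((heq ⟨b.src, b.dir⟩ hb).1) rfl rfl, hξeq]
    refine lt_of_le_of_lt (hS0 b hb) ?_
    have := hc0 j
    rw [hS₀f] at this
    linarith
  · -- the C¹ cancelled sum `< s₁` (crude)
    intro q hq
    obtain ⟨h0, hμ, hν, hμν⟩ := hq
    have hbμ : (⟨q.1, q.2.1⟩ : PBond (F.P k) 0) ∈ (frameI (Residual.unit (F.P k) (MatA N)) M j (domSites (F.P k) M j Y)).X.bonds := ⟨h0, hμ⟩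
    have hbν : (⟨q.1, q.2.2⟩ : PBond (F.P k) 0) ∈ (frameI (Residual.unit (F.P k) (MatA N)) M j (domSites (F.P k) M j Y)).X.bonds := ⟨h0, hν⟩
    have hbμν : (⟨q.1.shift q.2.1, q.2.2⟩ : PBond (F.P k) 0) ∈ (frameI (Residual.unit (F.P k) (MatA N)) M j (domSites (F.P k) M j Y)).X.bonds := ⟨hμ, hμν⟩
    rw [nabla_congr (V := fieldShift (sitesPerDir_ladder F (K := k) (j := 0) rfl rfl) (avgUnits U))
      (G := fun y => (I * ((F.P k).eta j : ℂ))⁻¹ • mlog ((((TΦOfRecord F N k Φ).U ⟨y, q.2.2⟩ : (MatA N)ˣ) : MatA N) *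
          (((fieldShift (sitesPerDir_ladder F (K := k) (j := 0) rfl rfl) (avgUnits U) ⟨y, q.2.2⟩)⁻¹ : (MatA N)ˣ) : MatA N)) -
        I • nabla (StepConsts.ofParams (F.P k) (Sg k).cB j).ξ (fieldShift (sitesPerDir_ladder F (K := k) (j := 0) rfl rfl) (avgUnits U)) q.2.2 _ y)
      ((heq _ hbμ).1) ?_ ?_, hξeq]
    · refine lt_of_le_of_lt (hS1 q ⟨h0, hμ, hν, hμν⟩) ?_
      have := hc1 j
      rw [hS₁f, hξeq] at this
      linarith
    · show AA ⟨q.1, q.2.2⟩ - I • nabla _ UA q.2.2 _ q.1 = _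
      rw [(heq _ hbν).2, nabla_congr (V := fieldShift (sitesPerDir_ladder F (K := k) (j := 0) rfl rfl) (avgUnits U)) (G := _) ((heq _ hbν).1) rfl rfl]
    · show AA ⟨q.1.shift q.2.1, q.2.2⟩ - I • nabla _ UA q.2.2 _ (q.1.shift q.2.1) = _
      rw [(heq _ hbμν).2, nabla_congr (V := fieldShift (sitesPerDir_ladder F (K := k) (j := 0) rfl rfl) (avgUnits U)) (G := _) ((heq _ hbμν).1) rfl rfl]

end Record

end YMDAG.N18.TransportOfRecord

end
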